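import Summits.BirchSwinnertonDyer.BirchSwinnertonDyer.Theorems.CyclotomicUntwistGNineConverseNewton
import Literature.NumberTheory.EllipticCurves.SelmerFiniteProofs
import Literature.NumberTheory.AdelicBaseChange.AdicCompletionDensity
import Summits.BirchSwinnertonDyer.Rank1Residual.Additive.TypeGThreeUnitJ
import Literature.NumberTheory.EllipticCurves.NeronLocalHeightCompletion
import HarnessLib

/-!
# Converse of `GNineCriterion`: extracting an integral approximate root from good reduction

Support file for the crux `PSRankOneLowerHalfAtThree` (K1) of the route `CyclotomicUntwist`
(sub-problem `BirchSwinnertonDyer`), part of the converse of `GNineCriterion`.  For `L` with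
`IsCyclotomicExtension {9} ℚ L`, `w ∋ 3` its place (residue field `𝔽₃`), and `W/ℚ` with
`2`-cleared cubic `F = X³ + AX² + BX + C` (`disc F = 2⁸Δ = 3^v·U`, `v` even, `U ≡ 2 (mod 3)`):
if `W_L` has good reduction at `w` then `F` has `w`-adic approximate roots in `𝓞 L` to every
precision (`exists_integer_approx_root`).  A `w`-integral model `(u, r, s, t)·W` with unit
discriminant has `2`-cleared cubic `F′` with `F(u²X′ + 4r) = u⁶F′(X′)` and
`disc F′ = (3^{v/2}u⁻⁶)²·U ≡ 2 (mod 𝔪_w)`, a non-square in `𝔽₃`, so `F′ mod 𝔪_w` has a simple root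
in `𝔽₃` (`exists_simple_root_mod_three`); Newton's iteration (`newton_iter`) in `L_w`, the
substitution `X = u²X′ + 4r` and density of `𝓞 L` in `𝒪_w` finish.

References: J. H. Silverman, *AEC*, III.1, VII.1, VII.5.1; J. Neukirch, *Algebraic Number Theory*,
II (4.6).
-/

set_option linter.dupNamespace false

open scoped NumberField

open IsDedekindDomain IsDedekindDomain.HeightOneSpectrum NumberField WeierstrassCurve WithZero
  Literature.NumberTheory.LFunctions Summit.BirchSwinnertonDyer.Rank1Residual.Additive

namespace Summit.BirchSwinnertonDyer.BirchSwinnertonDyer.Theorems.GNineConverse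

section Transport

/-- Transport of the `2`-cleared cubic under `x = u²x′ + 4r`: with the `b`-invariants of
`(u, r, s, t)·W` expressed through those of `W` (Silverman III.1, Table 1.2),
`F(u²X′ + 4r) = u⁶ F′(X′)`. [cite: SilvermanAEC2009, III.1 Table 1.2] -/
theorem cubic_transport {K : Type*} [Field K] (A B C u r y : K) (hu : u ≠ 0) (h8 : (8 : K) ≠ 0) :
    (u ^ 2 * y + 4 * r) ^ 3 + A * (u ^ 2 * y + 4 * r) ^ 2 + B * (u ^ 2 * y + 4 * r) + C =
      u ^ 6 * (y ^ 3 + (u⁻¹ ^ 2 * (A + 12 * r)) * y ^ 2 +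
        (8 * (u⁻¹ ^ 4 * (B / 8 + r * A + 6 * r ^ 2))) * y +
        16 * (u⁻¹ ^ 6 * (C / 16 + 2 * r * (B / 8) + r ^ 2 * A + 4 * r ^ 3))) := by
  have h2 : (2 : K) ≠ 0 := by
    intro h; apply h8; rw [show (8 : K) = 2 * 2 * 2 by norm_num, h]; ring
  have h16 : (16 : K) ≠ 0 := by
    rw [show (16 : K) = 2 * 8 by norm_num]; exact mul_ne_zero h2 h8
  field_simp
  ring

end Transport

section Completion

variable {L : Type} [Field L] [NumberField L] (w : HeightOneSpectrum (𝓞 L))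

/-- The coercion `L → L_w` is the structure map. [folklore] -/
theorem coe_adicCompletion_eq_algebraMap (x : L) :
    (x : w.adicCompletion L) = algebraMap L (w.adicCompletion L) x := by
  rw [algebraMap_adicCompletion]; simp

/-- `|n|_w` computed in `L_w` agrees with `w(n)` for an integer `n`. [folklore] -/
theorem valued_intCast (n : ℤ) :
    Valued.v ((n : ℤ) : w.adicCompletion L) = w.valuation L (n : L) := by
  rw [← map_intCast (algebraMap L (w.adicCompletion L)) n, ← coe_adicCompletion_eq_algebraMap,
    valuedAdicCompletion_eq_valuation']

/-- Units of `𝒪_w` have absolute value `1`. [folklore] -/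
theorem valued_eq_one_of_isUnit {m : w.adicCompletionIntegers L} (hm : IsUnit m) :
    Valued.v (m : w.adicCompletion L) = 1 := by
  obtain ⟨u, rfl⟩ := hm
  apply le_antisymm u.1.2
  have h1 : Valued.v ((u.1 : w.adicCompletion L) * ((↑u⁻¹ : w.adicCompletionIntegers L) :
      w.adicCompletion L)) = 1 := by
    rw [← Subring.coe_mul, u.mul_inv]; simp
  rw [Valuation.map_mul] at h1
  by_contra hlt
  rw [not_le] at hlt
  have : Valued.v (u.1 : w.adicCompletion L) *
      Valued.v ((↑u⁻¹ : w.adicCompletionIntegers L) : w.adicCompletion L) < 1 :=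
    mul_lt_one_of_lt_of_le hlt (u⁻¹).1.2
  exact absurd h1 this.ne

/-- `|F(R)|_w` computed in `L_w` agrees with `w(F(R))` for an integer cubic `F` and `R ∈ 𝓞 L`.
[folklore] -/
theorem valued_cubic_coe (R : 𝓞 L) (A B C : ℤ) :
    Valued.v (((R : L) : w.adicCompletion L) ^ 3 +
        (A : w.adicCompletion L) * ((R : L) : w.adicCompletion L) ^ 2 +
        (B : w.adicCompletion L) * ((R : L) : w.adicCompletion L) + (C : w.adicCompletion L)) =
      w.valuation L ((R : L) ^ 3 + A * (R : L) ^ 2 + B * (R : L) + C) := by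
  rw [← valuedAdicCompletion_eq_valuation' w, coe_adicCompletion_eq_algebraMap,
    coe_adicCompletion_eq_algebraMap]
  simp only [map_add, map_mul, map_pow, map_intCast]

variable [hL : IsCyclotomicExtension {3 ^ (1 + 1)} ℚ L] (hw : (3 : 𝓞 L) ∈ w.asIdeal)
include hw

/-- Integers prime to `3` are units of `L_w`. [folklore] -/
theorem valued_intCast_eq_one {n : ℤ} (hn : ¬ (3 : ℤ) ∣ n) :
    Valued.v ((n : ℤ) : w.adicCompletion L) = 1 := by
  rw [valued_intCast]; exact (GNineCriterion.placeData_nine w hw).2.2 n hn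

/-- Multiples of `3` are topologically nilpotent in `L_w`: `|n|_w < 1`. [folklore] -/
theorem valued_intCast_lt_one {n : ℤ} (hn : (3 : ℤ) ∣ n) :
    Valued.v ((n : ℤ) : w.adicCompletion L) < 1 := by
  rw [valued_intCast]; exact (val_intCast_lt_one_iff w hw n).mpr hn

/-- **Residue field `𝔽₃` of `𝒪_w`.** Every `w`-adic integer of `L_w` is within distance `< 1` of
`0`, `1` or `2` (density of `𝓞 L` in `𝒪_w` and `exists_int_residue`). [cite: Washington1997, Lemma 1.4] -/
theorem exists_residue (x : w.adicCompletion L) (hx : Valued.v x ≤ 1) :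
    ∃ n : ℤ, (n = 0 ∨ n = 1 ∨ n = 2) ∧ Valued.v (x - n) < 1 := by
  have hxO : x ∈ w.adicCompletionIntegers L := hx
  obtain ⟨a, ha⟩ := exists_adicValued_sub_lt_of_adicCompletionInteger L w ⟨x, hxO⟩ 1
  obtain ⟨n, hn, hres⟩ := exists_int_residue_val w hw a
  refine ⟨n, hn, ?_⟩
  have h1 : Valued.v (((a : L) : w.adicCompletion L) - n) < 1 := by
    have e : (((a : L) : w.adicCompletion L) - n) =
        algebraMap L (w.adicCompletion L) ((a : L) - n) := by
      rw [map_sub, map_intCast, coe_adicCompletion_eq_algebraMap]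
    rw [e, ← coe_adicCompletion_eq_algebraMap, valuedAdicCompletion_eq_valuation']
    exact hres
  have h2 : Valued.v (x - ((a : L) : w.adicCompletion L)) < 1 := by
    rw [← Valuation.map_neg, neg_sub]; simpa using ha
  have e : x - n = (x - ((a : L) : w.adicCompletion L)) + (((a : L) : w.adicCompletion L) - n) := by
    ring
  rw [e]
  exact Valued.v.map_add_lt h2 h1

end Completion

section Extract

variable {L : Type} [Field L] [NumberField L] [hL : IsCyclotomicExtension {3 ^ (1 + 1)} ℚ L]
  (w : HeightOneSpectrum (𝓞 L)) (hw : (3 : 𝓞 L) ∈ w.asIdeal)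
include hw

set_option maxHeartbeats 400000 in
/-- **Integral approximate roots from good reduction over `ℚ(ζ₉)`.** Let `W/ℚ` have good
reduction at the place `w ∋ 3` of the `9`-th cyclotomic field `L`, and let
`F = X³ + AX² + BX + C` be its `2`-cleared cubic (`A = b₂`, `B = 8b₄`, `C = 16b₆`) with
`disc F = 3^v·U`, `v` even, `U ≡ 2 (mod 3)`.  Then for every `N` there is `R ∈ 𝓞 L` with
`w(F(R)) ≤ exp(−N)`: the `2`-cleared cubic `F′` of a `w`-integral model with unit discriminant
satisfies `F(u²X′ + 4r) = u⁶F′(X′)` and `disc F′ ≡ 2·(unit)² (mod 𝔪_w)`, a non-square in the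
residue field `𝔽₃`, so `F′` has a simple root modulo `𝔪_w`; Newton's iteration in `L_w` and
density of `𝓞 L` in `𝒪_w` finish. [cite: SilvermanAEC2009, VII.1 and VII.5.1(a)] [cite: NeukirchANT1999, Ch. II (4.6)] -/
theorem exists_integer_approx_root (W : WeierstrassCurve ℚ)
    (hgood : (W.baseChange L).HasGoodReductionAt w)
    (A B C : ℤ) (hA : (A : ℚ) = W.b₂) (hB : (B : ℚ) = 8 * W.b₄) (hC : (C : ℚ) = 16 * W.b₆)
    (v : ℕ) (U : ℤ) (hv : Even v) (hU : (3 : ℤ) ∣ U - 2)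
    (hD : (A : ℚ) ^ 2 * B ^ 2 - 4 * B ^ 3 - 4 * A ^ 3 * C - 27 * C ^ 2 + 18 * A * B * C =
      3 ^ v * U)
    (N : ℕ) :
    ∃ R : 𝓞 L, w.valuation L ((R : L) ^ 3 + A * (R : L) ^ 2 + B * (R : L) + C) ≤
      exp (-(N : ℤ)) := by
  -- the completion and an integral model with unit discriminant
  obtain ⟨Cv, M, hCM, hMΔ⟩ := (W.baseChange L).exists_integralModel_of_hasGoodReductionAt hgood
  set ι := algebraMap (w.adicCompletionIntegers L) (w.adicCompletion L) with hιdef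
  have hι : ∀ m : w.adicCompletionIntegers L, ι m = (m : w.adicCompletion L) := fun m ↦ rfl
  set V := (W.baseChange L).baseChange (w.adicCompletion L) with hVdef
  set u : w.adicCompletion L := (Cv.u : w.adicCompletion L) with hudef
  set r : w.adicCompletion L := Cv.r with hrdef
  have hu : u ≠ 0 := Cv.u.ne_zero
  haveI : CharZero (w.adicCompletion L) :=
    charZero_of_injective_algebraMap (algebraMap L (w.adicCompletion L)).injective
  have h8 : (8 : w.adicCompletion L) ≠ 0 := by
    rw [← map_ofNat (algebraMap L (w.adicCompletion L)) 8]
    exact (map_ne_zero _).mpr (by norm_num)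
  -- `b`-invariants of `V = W / L_w`
  have hVb₂ : V.b₂ = (A : w.adicCompletion L) := by
    rw [hVdef, baseChange, baseChange, map_b₂, map_b₂, ← hA, map_intCast, map_intCast]
  have hVb₄ : V.b₄ = (B : w.adicCompletion L) / 8 := by
    have : W.b₄ = (B : ℚ) / 8 := by rw [hB]; ring
    rw [hVdef, baseChange, baseChange, map_b₄, map_b₄, this, map_div₀, map_intCast, map_div₀,
      map_intCast, map_ofNat, map_ofNat]
  have hVb₆ : V.b₆ = (C : w.adicCompletion L) / 16 := by
    have : W.b₆ = (C : ℚ) / 16 := by rw [hC]; ring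
    rw [hVdef, baseChange, baseChange, map_b₆, map_b₆, this, map_div₀, map_intCast, map_div₀,
      map_intCast, map_ofNat, map_ofNat]
  have hVΔ : 256 * V.Δ = (3 : w.adicCompletion L) ^ v * U := by
    have hQ : 256 * W.Δ = (3 : ℚ) ^ v * U := by
      rw [← disc_b_eq W, ← hD, ← hA, ← hB, ← hC]
    have : 256 * V.Δ = algebraMap L (w.adicCompletion L) (algebraMap ℚ L (256 * W.Δ)) := by
      rw [hVdef, baseChange, baseChange, map_Δ, map_Δ, map_mul, map_mul, map_ofNat, map_ofNat]
    rw [this, hQ]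
    simp only [map_mul, map_pow, map_intCast, map_ofNat]
  -- the `2`-cleared cubic `F'` of the integral model `Cv • V = M`
  set α : w.adicCompletion L := ι M.b₂ with hαdef
  set β : w.adicCompletion L := 8 * ι M.b₄ with hβdef
  set γ : w.adicCompletion L := 16 * ι M.b₆ with hγdef
  have hα1 : Valued.v α ≤ 1 := by rw [hαdef, hι]; exact (M.b₂).2
  have hβ1 : Valued.v β ≤ 1 := by
    rw [hβdef, Valuation.map_mul, hι]
    exact mul_le_one' (by simpa using valuation_natCast_le_one Valued.v 8) (M.b₄).2
  have hγ1 : Valued.v γ ≤ 1 := by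
    rw [hγdef, Valuation.map_mul, hι]
    exact mul_le_one' (by simpa using valuation_natCast_le_one Valued.v 16) (M.b₆).2
  have hCu : (↑Cv.u⁻¹ : w.adicCompletion L) = u⁻¹ := by rw [Units.val_inv_eq_inv_val]
  have hαe : α = u⁻¹ ^ 2 * ((A : w.adicCompletion L) + 12 * r) := by
    rw [hαdef, show ι M.b₂ = (Cv • V).b₂ by rw [hCM, map_b₂], variableChange_b₂, hCu, hVb₂]
  have hβe : β = 8 * (u⁻¹ ^ 4 * ((B : w.adicCompletion L) / 8 + r * A + 6 * r ^ 2)) := by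
    rw [hβdef, show ι M.b₄ = (Cv • V).b₄ by rw [hCM, map_b₄], variableChange_b₄, hCu, hVb₂, hVb₄]
  have hγe : γ = 16 * (u⁻¹ ^ 6 *
      ((C : w.adicCompletion L) / 16 + 2 * r * ((B : w.adicCompletion L) / 8) + r ^ 2 * A +
        4 * r ^ 3)) := by
    rw [hγdef, show ι M.b₆ = (Cv • V).b₆ by rw [hCM, map_b₆], variableChange_b₆, hCu, hVb₂,
      hVb₄, hVb₆]
  -- transport identity `F(u² y + 4 r) = u⁶ F'(y)`
  have htrans : ∀ y : w.adicCompletion L,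
      (u ^ 2 * y + 4 * r) ^ 3 + (A : w.adicCompletion L) * (u ^ 2 * y + 4 * r) ^ 2 +
        B * (u ^ 2 * y + 4 * r) + C = u ^ 6 * (y ^ 3 + α * y ^ 2 + β * y + γ) := by
    intro y; rw [hαe, hβe, hγe]; exact cubic_transport _ _ _ u r y hu h8
  -- discriminant of `F'`: a unit, congruent to `2`
  have hdisc : α ^ 2 * β ^ 2 - 4 * β ^ 3 - 4 * α ^ 3 * γ - 27 * γ ^ 2 + 18 * α * β * γ =
      256 * ι M.Δ := by
    have h := disc_b_eq (Cv • V)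
    rw [hCM, map_b₂, map_b₄, map_b₆, map_Δ] at h
    rw [hαdef, hβdef, hγdef]; exact h
  have hdisc' : α ^ 2 * β ^ 2 - 4 * β ^ 3 - 4 * α ^ 3 * γ - 27 * γ ^ 2 + 18 * α * β * γ =
      u⁻¹ ^ 12 * ((3 : w.adicCompletion L) ^ v * U) := by
    rw [hdisc, show ι M.Δ = (Cv • V).Δ by rw [hCM, map_Δ], variableChange_Δ, hCu, ← hVΔ]; ring
  have hvdisc : Valued.v (α ^ 2 * β ^ 2 - 4 * β ^ 3 - 4 * α ^ 3 * γ - 27 * γ ^ 2 +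
      18 * α * β * γ) = 1 := by
    rw [hdisc, Valuation.map_mul, hι, valued_eq_one_of_isUnit w hMΔ, mul_one]
    have := valued_intCast_eq_one w hw (n := 256) (by norm_num)
    simpa using this
  obtain ⟨k, hk⟩ := hv
  set e : w.adicCompletion L := 3 ^ k * u⁻¹ ^ 6 with hedef
  have hde : α ^ 2 * β ^ 2 - 4 * β ^ 3 - 4 * α ^ 3 * γ - 27 * γ ^ 2 + 18 * α * β * γ =
      e ^ 2 * U := by
    rw [hdisc', hedef, hk]; ring
  have hU3 : ¬ (3 : ℤ) ∣ U := by
    intro h; have := dvd_sub h hU; norm_num at this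
  have hvU : Valued.v ((U : ℤ) : w.adicCompletion L) = 1 := valued_intCast_eq_one w hw hU3
  have hve : Valued.v e = 1 := by
    have h2 : Valued.v e ^ 2 = 1 := by
      have := hvdisc; rwa [hde, Valuation.map_mul, Valuation.map_pow, hvU, mul_one] at this
    rcases lt_trichotomy (Valued.v e) 1 with h | h | h
    · exact absurd h2 (pow_lt_one₀ zero_le h two_ne_zero).ne
    · exact h
    · exact absurd h2 (one_lt_pow₀ h two_ne_zero).ne'
  -- `e² ≡ 1`, hence `disc F' ≡ U ≡ 2`
  have h3lt : Valued.v (3 : w.adicCompletion L) < 1 := by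
    have := valued_intCast_lt_one w hw (n := 3) dvd_rfl
    simpa using this
  have hve2 : Valued.v (e ^ 2 - 1) < 1 := by
    obtain ⟨n, hn, hres⟩ := exists_residue w hw e hve.le
    have hsplit : e ^ 2 - 1 = (e - n) * (e + n) + ((n : w.adicCompletion L) ^ 2 - 1) := by ring
    rw [hsplit]
    refine Valued.v.map_add_lt ?_ ?_
    · rw [Valuation.map_mul]
      refine mul_lt_one_of_lt_of_le hres (Valued.v.map_add_le hve.le ?_)
      exact valuation_intCast_le_one Valued.v n
    · rcases hn with rfl | rfl | rfl
      · exfalso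
        simp only [Int.cast_zero, sub_zero] at hres
        exact absurd hve hres.ne
      · simp
      · have : ((2 : ℤ) : w.adicCompletion L) ^ 2 - 1 = 3 := by norm_num
        rw [this]; exact h3lt
  have hdisc2 : Valued.v (α ^ 2 * β ^ 2 - 4 * β ^ 3 - 4 * α ^ 3 * γ - 27 * γ ^ 2 +
      18 * α * β * γ - 2) < 1 := by
    rw [hde, show e ^ 2 * (U : w.adicCompletion L) - 2 =
      (e ^ 2 - 1) * U + (((U - 2 : ℤ) : w.adicCompletion L)) by push_cast; ring]
    refine Valued.v.map_add_lt ?_ (valued_intCast_lt_one w hw hU)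
    rw [Valuation.map_mul, hvU, mul_one]; exact hve2
  -- residues of the coefficients and a simple root modulo `𝔪_w`
  set π := Ideal.Quotient.mk (IsLocalRing.maximalIdeal (w.adicCompletionIntegers L)) with hπdef
  have hmem : ∀ x : w.adicCompletionIntegers L,
      x ∈ IsLocalRing.maximalIdeal (w.adicCompletionIntegers L) ↔
        Valued.v (x : w.adicCompletion L) < 1 := fun x ↦
    mem_completionIdeal_iff L w x
  have hπeq : ∀ x y : w.adicCompletionIntegers L,
      π x = π y ↔ Valued.v (ι x - ι y) < 1 := fun x y ↦ by
    rw [hπdef, Ideal.Quotient.eq, hmem, ← hι, map_sub]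
  set αO : w.adicCompletionIntegers L := M.b₂ with hαO
  set βO : w.adicCompletionIntegers L := 8 * M.b₄ with hβO
  set γO : w.adicCompletionIntegers L := 16 * M.b₆ with hγO
  have hαι : ι αO = α := by rw [hαO, hαdef]
  have hβι : ι βO = β := by rw [hβO, hβdef, map_mul, map_ofNat]
  have hγι : ι γO = γ := by rw [hγO, hγdef, map_mul, map_ofNat]
  obtain ⟨a, ha, hares⟩ := exists_residue w hw α hα1
  obtain ⟨b, hb, hbres⟩ := exists_residue w hw β hβ1
  obtain ⟨c, hc, hcres⟩ := exists_residue w hw γ hγ1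
  have hπa : π αO = π (a : w.adicCompletionIntegers L) :=
    (hπeq _ _).mpr (by rwa [hαι, map_intCast])
  have hπb : π βO = π (b : w.adicCompletionIntegers L) :=
    (hπeq _ _).mpr (by rwa [hβι, map_intCast])
  have hπc : π γO = π (c : w.adicCompletionIntegers L) :=
    (hπeq _ _).mpr (by rwa [hγι, map_intCast])
  -- `disc g ≡ disc F' ≡ 2 (mod 3)` for the integer cubic `g = X³ + aX² + bX + c`
  have hdg : (3 : ℤ) ∣ a ^ 2 * b ^ 2 - 4 * b ^ 3 - 4 * a ^ 3 * c - 27 * c ^ 2 + 18 * a * b * c - 2 := by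
    set dg : ℤ := a ^ 2 * b ^ 2 - 4 * b ^ 3 - 4 * a ^ 3 * c - 27 * c ^ 2 + 18 * a * b * c with hdgdef
    have hπd : π (αO ^ 2 * βO ^ 2 - 4 * βO ^ 3 - 4 * αO ^ 3 * γO - 27 * γO ^ 2 +
        18 * αO * βO * γO) = π (dg : w.adicCompletionIntegers L) := by
      simp only [map_sub, map_add, map_mul, map_pow, map_ofNat, hπa, hπb, hπc, map_intCast, hdgdef]
      push_cast; ring
    have hd1 : Valued.v ((α ^ 2 * β ^ 2 - 4 * β ^ 3 - 4 * α ^ 3 * γ - 27 * γ ^ 2 +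
        18 * α * β * γ) - dg) < 1 := by
      have h := (hπeq _ _).mp hπd
      simp only [map_sub, map_add, map_mul, map_pow, map_ofNat, map_intCast, hαι, hβι, hγι] at h
      exact h
    have hd2 : Valued.v (((dg - 2 : ℤ) : w.adicCompletion L)) < 1 := by
      have e : ((dg - 2 : ℤ) : w.adicCompletion L) =
          (α ^ 2 * β ^ 2 - 4 * β ^ 3 - 4 * α ^ 3 * γ - 27 * γ ^ 2 + 18 * α * β * γ - 2) -
          ((α ^ 2 * β ^ 2 - 4 * β ^ 3 - 4 * α ^ 3 * γ - 27 * γ ^ 2 + 18 * α * β * γ) - dg) := by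
        push_cast; ring
      rw [e]; exact Valued.v.map_sub_lt hdisc2 hd1
    by_contra hnd
    exact absurd (valued_intCast_eq_one w hw hnd) hd2.ne
  obtain ⟨r₀, hr₀, hg, hg'⟩ := exists_simple_root_mod_three ha hb hc hdg
  -- the starting point `x₀ = r₀` of Newton's iteration
  have hx₀ : Valued.v ((r₀ : ℤ) : w.adicCompletion L) ≤ 1 := valuation_intCast_le_one Valued.v r₀
  have hπg : π ((r₀ : w.adicCompletionIntegers L) ^ 3 + αO * r₀ ^ 2 + βO * r₀ + γO) =
      π ((r₀ ^ 3 + a * r₀ ^ 2 + b * r₀ + c : ℤ) : w.adicCompletionIntegers L) := by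
    simp only [map_add, map_mul, map_pow, hπa, hπb, hπc, map_intCast]
    push_cast; ring
  have hπg' : π (3 * (r₀ : w.adicCompletionIntegers L) ^ 2 + 2 * αO * r₀ + βO) =
      π ((3 * r₀ ^ 2 + 2 * a * r₀ + b : ℤ) : w.adicCompletionIntegers L) := by
    simp only [map_add, map_mul, map_pow, map_ofNat, hπa, hπb, map_intCast]
    push_cast; ring
  have hfx₀ : Valued.v (((r₀ : ℤ) : w.adicCompletion L) ^ 3 + α * r₀ ^ 2 + β * r₀ + γ) < 1 := by
    have h1 : Valued.v ((((r₀ : ℤ) : w.adicCompletion L) ^ 3 + α * r₀ ^ 2 + β * r₀ + γ) -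
        ((r₀ ^ 3 + a * r₀ ^ 2 + b * r₀ + c : ℤ) : w.adicCompletion L)) < 1 := by
      have h := (hπeq _ _).mp hπg
      simp only [map_add, map_mul, map_pow, map_intCast, hαι, hβι, hγι] at h
      exact h
    have h2 := valued_intCast_lt_one w hw hg
    have := Valued.v.map_add_lt h1 h2
    rwa [sub_add_cancel] at this
  have hdx₀ : Valued.v (3 * ((r₀ : ℤ) : w.adicCompletion L) ^ 2 + 2 * α * r₀ + β) = 1 := by
    have h1 : Valued.v ((3 * ((r₀ : ℤ) : w.adicCompletion L) ^ 2 + 2 * α * r₀ + β) -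
        ((3 * r₀ ^ 2 + 2 * a * r₀ + b : ℤ) : w.adicCompletion L)) < 1 := by
      have h := (hπeq _ _).mp hπg'
      simp only [map_add, map_mul, map_pow, map_ofNat, map_intCast, hαι, hβι] at h
      exact h
    have h2 := valued_intCast_eq_one w hw hg'
    have e : (3 * ((r₀ : ℤ) : w.adicCompletion L) ^ 2 + 2 * α * r₀ + β) =
        ((3 * r₀ ^ 2 + 2 * a * r₀ + b : ℤ) : w.adicCompletion L) +
        ((3 * ((r₀ : ℤ) : w.adicCompletion L) ^ 2 + 2 * α * r₀ + β) -
          ((3 * r₀ ^ 2 + 2 * a * r₀ + b : ℤ) : w.adicCompletion L)) := by ring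
    rw [e, Valued.v.map_add_eq_of_lt_left (by rw [h2]; exact h1), h2]
  -- Newton's iteration to precision `exp(-(N + 6 m))`, `|u|_w = exp m`
  set m : ℤ := log (Valued.v u) with hmdef
  have hvu : Valued.v u = exp m := by rw [hmdef, exp_log ((Valuation.ne_zero_iff _).mpr hu)]
  set n : ℕ := N + 6 * m.toNat with hndef
  obtain ⟨y, hy1, hfy, -⟩ := newton_iter hα1 hx₀ hfx₀ hdx₀ n
  have hfy' : Valued.v (y ^ 3 + α * y ^ 2 + β * y + γ) ≤ exp (-(2 ^ n : ℕ) : ℤ) := by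
    refine hfy.trans ?_
    have h0 := Rat.HeightOneSpectrum.le_exp_neg_one_of_lt_one hfx₀
    calc Valued.v (((r₀ : ℤ) : w.adicCompletion L) ^ 3 + α * r₀ ^ 2 + β * r₀ + γ) ^ 2 ^ n
        ≤ exp (-1 : ℤ) ^ 2 ^ n := pow_le_pow_left₀ zero_le h0 _
      _ = exp (-(2 ^ n : ℕ) : ℤ) := by rw [← exp_nsmul]; congr 1; simp
  -- back to `F`: `X = u² y + 4 r`
  set X : w.adicCompletion L := u ^ 2 * y + 4 * r with hXdef
  have hFX : Valued.v (X ^ 3 + (A : w.adicCompletion L) * X ^ 2 + B * X + C) ≤ exp (-(N : ℤ)) := by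
    rw [hXdef, htrans y, Valuation.map_mul, Valuation.map_pow, hvu, ← exp_nsmul]
    calc exp ((6 : ℕ) • m) * Valued.v (y ^ 3 + α * y ^ 2 + β * y + γ)
        ≤ exp ((6 : ℕ) • m) * exp (-(2 ^ n : ℕ) : ℤ) := mul_le_mul_right hfy' _
      _ = exp ((6 : ℕ) • m + -(2 ^ n : ℕ)) := by rw [exp_add]
      _ ≤ exp (-(N : ℤ)) := by
          rw [exp_le_exp]
          have h2n : (n : ℤ) < ((2 ^ n : ℕ) : ℤ) := by exact_mod_cast Nat.lt_two_pow_self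
          have hmn : m ≤ (m.toNat : ℤ) := Int.self_le_toNat m
          have hn' : (n : ℤ) = N + 6 * (m.toNat : ℤ) := by rw [hndef]; push_cast; ring
          rw [nsmul_eq_mul]
          push_cast at h2n ⊢
          linarith
  have hA1 : Valued.v ((A : ℤ) : w.adicCompletion L) ≤ 1 := valuation_intCast_le_one Valued.v A
  have hB1 : Valued.v ((B : ℤ) : w.adicCompletion L) ≤ 1 := valuation_intCast_le_one Valued.v B
  have hC1 : Valued.v ((C : ℤ) : w.adicCompletion L) ≤ 1 := valuation_intCast_le_one Valued.v C
  have hN1 : exp (-(N : ℤ)) ≤ (1 : ℤᵐ⁰) := by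
    rw [← exp_zero, exp_le_exp]; omega
  have hX1 : Valued.v X ≤ 1 := val_le_one_of_val_eval_le_one hA1 hB1 hC1 (hFX.trans hN1)
  -- approximate `X` from `𝓞 L`
  have hXO : X ∈ w.adicCompletionIntegers L := hX1
  obtain ⟨R, hR⟩ := exists_adicValued_sub_lt_of_adicCompletionInteger L w ⟨X, hXO⟩
    (Units.mk0 (exp (-(N : ℤ))) exp_ne_zero)
  refine ⟨R, ?_⟩
  rw [← valued_cubic_coe w R A B C]
  set z : w.adicCompletion L := ((R : L) : w.adicCompletion L) with hzdef
  have hz1 : Valued.v z ≤ 1 := by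
    rw [hzdef, valuedAdicCompletion_eq_valuation']; exact valuation_le_one w R
  have hzX : Valued.v (z - X) < exp (-(N : ℤ)) := by simpa [hzdef] using hR
  have hdiff := val_eval_sub_le_val_sub (C := ((C : ℤ) : w.adicCompletion L)) hA1 hB1 hX1 hz1
  have hsplit : z ^ 3 + (A : w.adicCompletion L) * z ^ 2 + B * z + C =
      (X ^ 3 + (A : w.adicCompletion L) * X ^ 2 + B * X + C) +
      ((z ^ 3 + (A : w.adicCompletion L) * z ^ 2 + B * z + C) -
        (X ^ 3 + (A : w.adicCompletion L) * X ^ 2 + B * X + C)) := by ring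
  rw [hsplit]
  exact Valued.v.map_add_le hFX (hdiff.trans hzX.le)

end Extract

end Summit.BirchSwinnertonDyer.BirchSwinnertonDyer.Theorems.GNineConverse
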